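import Summits.CriticalPhenomena.PercolationContinuityZ3.Theorems.PercNearOneGluingNoHeavyQuantFarBundlePocket
import Literature.Probability.LatticeModels.ProdBernoulliIndependence
import Literature.Probability.LatticeModels.ProdBernoulliClusterLocality
import Literature.Probability.LatticeModels.ProdBernoulliAtomExpansion
import HarnessLib

/-!
# QUANT lane R8, front "FAR beyond trees", layer one — the BUNDLE DICHOTOMY, graph side II: the law decomposition `P(N ≥ 2) = A + B·h + C·t`

builds on p205010 (kernel theorem, internal audit signed; external expert review pending)

Support file (`--supports stmt-CriticalPhenomena-4575`), seat `prim-quant-p1` (gen 18); memo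
`run/shared/lean/prim/quant/prim-quant-p1-g18/FOR-LEAD-UNICYCLIC-TREES.md` §1 (D) (kernel plan §6, file F-B part 2).
Standard axioms; no sorries; no definitions.

For a weight function `v : Sym2 (Fin n) → [0,1]` that vanishes on every non-allowed pair meeting the pocket `Z = insert u Lf`
(`Bundle.IsPocket`, `Bundle.Allowed` of part I), the configuration is almost surely `Bundle.Good`, so by `Bundle.card_filter_eq` the relay
count of the observer is `N = N_rest + J · X` with `N_rest`, `J = 𝟙[o ↔ p off Z]` determined by the pairs AVOIDING `Z` and the pocket count
`X = #{ℓ ∈ Lf : pocket ℓ}` determined by the pairs MEETING `Z`; independence of disjoint coordinate sets (`prodBernoulli_real_inter_of_determinedBy`)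
gives

* `Bundle.real_two_le_card_eq` — **(D)**: `P_v(N ≥ 2) = P_v(N_rest ≥ 2) + P_v(N_rest = 1, J) · P_v(X ≥ 1) + P_v(N_rest = 0, J) · P_v(X ≥ 2)`;
* `Bundle.real_openConn_leaf_eq` — marginal of a leaf: `P_v(o ↔ ℓ) = P_v(J) · P_v(pocket ℓ)`;  `Bundle.real_openConn_off_eq` — for `a ∉ Z`,
  `P_v(o ↔ a) = P_v(o ↔ a off Z)`;
* `Bundle.real_offZ_event_eq_of_agree` — the coefficients (any event read off `offZ`) agree for two weight functions that agree on the pairs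
  avoiding `Z` (`prodBernoulli_real_eq_of_determinedBy`).
[cite: Grimmett1999, §1.3 p. 10; §2.2] (product measure; events determined by finitely many coordinates); bookkeeping [this work].
-/

noncomputable section

namespace Summit.CriticalPhenomena.PercolationContinuityZ3.Theorems

namespace Quant

namespace Bundle

open Finset MeasureTheory Set
open Literature.Probability.LatticeModels
open Literature.Probability.Percolation
open scoped Classical

variable {n : ℕ}

/-! ## Pairs avoiding the pocket; determinacy -/

/-- The pairs avoiding `Z`. [this work] -/
def avoid (Z : Finset (Fin n)) : Finset (Sym2 (Fin n)) := Finset.univ.filter fun e => ∀ z ∈ Z, z ∉ e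

/-- `offZ Z ω` is `ω` restricted to the pairs avoiding `Z`. [this work] -/
theorem offZ_eq_inter (Z : Finset (Fin n)) (ω : BondConfig (Fin n)) : offZ Z ω = ω ∩ ↑(avoid Z) := by
  ext e; simp [offZ, avoid]

/-- Any event read off `offZ Z` is determined by the pairs avoiding `Z`. [this work] -/
theorem determinedBy_offZ (Z : Finset (Fin n)) (P : BondConfig (Fin n) → Prop) :
    DeterminedBy {ω : BondConfig (Fin n) | P (offZ Z ω)} (↑(avoid Z) : Set (Sym2 (Fin n))) := by
  rw [determinedBy_iff]
  intro ω ω' h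
  simp only [mem_setOf_eq, offZ_eq_inter, h]

/-- Membership of a pair meeting `Z` is determined by the complement of `avoid Z`. [this work] -/
theorem mem_iff_of_inter_compl_eq {Z : Finset (Fin n)} {ω ω' : BondConfig (Fin n)}
    (h : ω ∩ (↑(avoid Z) : Set (Sym2 (Fin n)))ᶜ = ω' ∩ (↑(avoid Z) : Set (Sym2 (Fin n)))ᶜ)
    {e : Sym2 (Fin n)} {z : Fin n} (hz : z ∈ Z) (hze : z ∈ e) : e ∈ ω ↔ e ∈ ω' := by
  have he : e ∈ (↑(avoid Z) : Set (Sym2 (Fin n)))ᶜ := by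
    intro hmem
    exact (Finset.mem_filter.1 (Finset.mem_coe.1 hmem)).2 z hz hze
  constructor
  · intro hω; exact (((Set.ext_iff.1 h) e).1 ⟨hω, he⟩).1
  · intro hω; exact (((Set.ext_iff.1 h) e).2 ⟨hω, he⟩).1

section Pocket

variable {o p u ℓ₁ : Fin n} {Lf : Finset (Fin n)} (H : IsPocket o p u ℓ₁ Lf)
include H

/-- `pocket ℓ` is determined by the pairs meeting `Z` (it reads only `s(p,u)`, `s(p,ℓ₁)`, `s(u,ℓ)`). [this work] -/
theorem pocket_iff_of_inter_compl_eq {ω ω' : BondConfig (Fin n)}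
    (h : ω ∩ (↑(avoid (insert u Lf)) : Set (Sym2 (Fin n)))ᶜ = ω' ∩ (↑(avoid (insert u Lf)) : Set (Sym2 (Fin n)))ᶜ) (ℓ : Fin n) :
    pocket p u ℓ₁ ω ℓ ↔ pocket p u ℓ₁ ω' ℓ := by
  have hu : u ∈ insert u Lf := mem_insert_self u Lf
  have h1 : ℓ₁ ∈ insert u Lf := mem_insert_of_mem H.l1
  have epu := mem_iff_of_inter_compl_eq h hu (Sym2.mem_mk_right p u)
  have epl := mem_iff_of_inter_compl_eq h h1 (Sym2.mem_mk_right p ℓ₁)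
  have eul1 := mem_iff_of_inter_compl_eq h hu (Sym2.mem_mk_left u ℓ₁)
  have eul := mem_iff_of_inter_compl_eq h hu (Sym2.mem_mk_left u ℓ)
  simp only [pocket, connU, epu, epl, eul1, eul]

/-- Any event read off the pocket counts is determined by the complement of `avoid Z`. [this work] -/
theorem determinedBy_pocket (P : (Fin n → Prop) → Prop) :
    DeterminedBy {ω : BondConfig (Fin n) | P (pocket p u ℓ₁ ω)} (↑(avoid (insert u Lf)) : Set (Sym2 (Fin n)))ᶜ := by
  rw [determinedBy_iff]
  intro ω ω' h
  have : pocket p u ℓ₁ ω = pocket p u ℓ₁ ω' := funext fun ℓ => propext (pocket_iff_of_inter_compl_eq H h ℓ)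
  simp only [mem_setOf_eq, this]

/-! ## Almost-sure goodness -/

omit H in
/-- If `v` vanishes on every non-allowed non-diagonal pair meeting `Z`, the configuration is almost surely good: events agreeing on good
configurations have the same probability. [this work] -/
theorem real_congr_of_good (v : Sym2 (Fin n) → unitInterval)
    (hv : ∀ x y : Fin n, x ≠ y → (x ∈ insert u Lf ∨ y ∈ insert u Lf) → ¬ Allowed p u ℓ₁ Lf s(x, y) → (v s(x, y) : ℝ) = 0)
    (S T : Set (BondConfig (Fin n))) (hST : ∀ ω, Good p u ℓ₁ Lf ω → (ω ∈ S ↔ ω ∈ T)) :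
    (prodBernoulli v).real S = (prodBernoulli v).real T := by
  set μ := prodBernoulli v with hμ
  -- the bad pairs
  set Bd : Finset (Sym2 (Fin n)) := Finset.univ.filter fun e => ¬ e.IsDiag ∧ (∃ z ∈ insert u Lf, z ∈ e) ∧
    ¬ Allowed p u ℓ₁ Lf e with hBd
  set Nbad : Set (BondConfig (Fin n)) := {ω | ∃ e ∈ Bd, e ∈ ω} with hN
  have hmeas : ∀ U : Set (BondConfig (Fin n)), MeasurableSet U := fun U => (Set.toFinite U).measurableSet
  have hN0 : μ.real Nbad = 0 := by
    have h0 : μ Nbad = 0 := by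
      apply prodBernoulli_setOf_exists_mem_eq_zero
      intro e he
      obtain ⟨hd, ⟨z, hz, hze⟩, hna⟩ := (Finset.mem_filter.1 he).2
      induction e using Sym2.ind with
      | h x y =>
        have hxy : x ≠ y := fun h => hd (by subst h; exact Sym2.mk_isDiag_iff.mpr rfl)
        rcases Sym2.mem_iff.1 hze with rfl | rfl
        · exact hv _ _ hxy (Or.inl hz) hna
        · exact hv _ _ hxy (Or.inr hz) hna
    simp [measureReal_def, h0]
  have hgood : ∀ ω : BondConfig (Fin n), ω ∉ Nbad → Good p u ℓ₁ Lf ω := by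
    intro ω hω x y hxy he hZ
    by_contra hna
    apply hω
    refine ⟨s(x, y), Finset.mem_filter.2 ⟨Finset.mem_univ _, ?_, ?_, hna⟩, he⟩
    · rw [Sym2.mk_isDiag_iff]; exact hxy
    · rcases hZ with h | h
      · exact ⟨x, h, Sym2.mem_mk_left x y⟩
      · exact ⟨y, h, Sym2.mem_mk_right x y⟩
  have hsplit : ∀ U : Set (BondConfig (Fin n)), μ.real U = μ.real (U \ Nbad) := by
    intro U
    have h := measureReal_inter_add_sdiff (μ := μ) (s := U) (hmeas Nbad)
    have h0 : μ.real (U ∩ Nbad) = 0 :=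
      le_antisymm ((measureReal_mono Set.inter_subset_right).trans hN0.le) measureReal_nonneg
    linarith
  have hdiff : S \ Nbad = T \ Nbad := by
    ext ω
    simp only [Set.mem_sdiff]
    constructor
    · rintro ⟨hS, hω⟩; exact ⟨(hST ω (hgood ω hω)).1 hS, hω⟩
    · rintro ⟨hT, hω⟩; exact ⟨(hST ω (hgood ω hω)).2 hT, hω⟩
  rw [hsplit S, hsplit T, hdiff]

/-! ## The decomposition (D) -/

/-- **(D)** `P_v(N ≥ 2) = P_v(N_rest ≥ 2) + P_v(N_rest = 1, J)·P_v(X ≥ 1) + P_v(N_rest = 0, J)·P_v(X ≥ 2)` for every weight function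
vanishing on the non-allowed pairs at the pocket; `N_rest`, `J` are read off `offZ`, `X = #{ℓ ∈ Lf : pocket ℓ}`. [this work] -/
theorem real_two_le_card_eq (v : Sym2 (Fin n) → unitInterval) {A : Finset (Fin n)} (hLA : Lf ⊆ A) (huA : u ∉ A)
    (hv : ∀ x y : Fin n, x ≠ y → (x ∈ insert u Lf ∨ y ∈ insert u Lf) → ¬ Allowed p u ℓ₁ Lf s(x, y) → (v s(x, y) : ℝ) = 0) :
    (prodBernoulli v).real {ω : BondConfig (Fin n) | 2 ≤ (A.filter fun a => ω ∈ openConn o a).card} =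
      (prodBernoulli v).real {ω | 2 ≤ ((A \ Lf).filter fun a => offZ (insert u Lf) ω ∈ openConn o a).card} +
      (prodBernoulli v).real {ω | ((A \ Lf).filter fun a => offZ (insert u Lf) ω ∈ openConn o a).card = 1 ∧
          offZ (insert u Lf) ω ∈ openConn o p} *
        (prodBernoulli v).real {ω | 1 ≤ (Lf.filter fun ℓ => pocket p u ℓ₁ ω ℓ).card} +
      (prodBernoulli v).real {ω | ((A \ Lf).filter fun a => offZ (insert u Lf) ω ∈ openConn o a).card = 0 ∧
          offZ (insert u Lf) ω ∈ openConn o p} *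
        (prodBernoulli v).real {ω | 2 ≤ (Lf.filter fun ℓ => pocket p u ℓ₁ ω ℓ).card} := by
  set μ := prodBernoulli v with hμ
  have hmeas : ∀ U : Set (BondConfig (Fin n)), MeasurableSet U := fun U => (Set.toFinite U).measurableSet
  set S := {ω : BondConfig (Fin n) | 2 ≤ (A.filter fun a => ω ∈ openConn o a).card} with hS
  set S2 := {ω : BondConfig (Fin n) | 2 ≤ ((A \ Lf).filter fun a => offZ (insert u Lf) ω ∈ openConn o a).card} with hS2
  set S1 := {ω : BondConfig (Fin n) | ((A \ Lf).filter fun a => offZ (insert u Lf) ω ∈ openConn o a).card = 1 ∧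
    offZ (insert u Lf) ω ∈ openConn o p} with hS1
  set S0 := {ω : BondConfig (Fin n) | ((A \ Lf).filter fun a => offZ (insert u Lf) ω ∈ openConn o a).card = 0 ∧
    offZ (insert u Lf) ω ∈ openConn o p} with hS0
  set X1 := {ω : BondConfig (Fin n) | 1 ≤ (Lf.filter fun ℓ => pocket p u ℓ₁ ω ℓ).card} with hX1
  set X2 := {ω : BondConfig (Fin n) | 2 ≤ (Lf.filter fun ℓ => pocket p u ℓ₁ ω ℓ).card} with hX2
  set T := S2 ∪ (S1 ∩ X1 ∪ S0 ∩ X2) with hT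
  -- `S = T` on good configurations
  have hST : μ.real S = μ.real T := by
    refine real_congr_of_good (p := p) (u := u) (ℓ₁ := ℓ₁) (Lf := Lf) v hv S T fun ω hω => ?_
    have hcard := card_filter_eq H hω hLA huA
    simp only [hS, hT, hS2, hS1, hS0, hX1, hX2, mem_setOf_eq, Set.mem_union, Set.mem_inter_iff]
    rw [hcard]
    by_cases hj : offZ (insert u Lf) ω ∈ openConn o p
    · rw [if_pos hj]
      simp only [hj, and_true]
      omega
    · rw [if_neg hj]
      simp only [hj, and_false, false_and, or_false, add_zero]
  -- disjointness
  have hd1 : Disjoint (S1 ∩ X1) (S0 ∩ X2) := by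
    rw [Set.disjoint_left]
    rintro ω ⟨⟨h1, -⟩, -⟩ ⟨⟨h0, -⟩, -⟩
    omega
  have hd2 : Disjoint S2 (S1 ∩ X1 ∪ S0 ∩ X2) := by
    rw [Set.disjoint_left]
    rintro ω h2 (⟨⟨h1, -⟩, -⟩ | ⟨⟨h0, -⟩, -⟩)
    · simp only [hS2, mem_setOf_eq] at h2; omega
    · simp only [hS2, mem_setOf_eq] at h2; omega
  have hTsum : μ.real T = μ.real S2 + μ.real (S1 ∩ X1) + μ.real (S0 ∩ X2) := by
    rw [hT, measureReal_union hd2 (hmeas _), measureReal_union hd1 (hmeas _), add_assoc]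
  -- independence: `S1`, `S0` are determined by `avoid Z`, `X1`, `X2` by its complement
  have hdetS1 : DeterminedBy S1 (↑(avoid (insert u Lf)) : Set (Sym2 (Fin n))) :=
    determinedBy_offZ (insert u Lf) fun η => ((A \ Lf).filter fun a => η ∈ openConn o a).card = 1 ∧ η ∈ openConn o p
  have hdetS0 : DeterminedBy S0 (↑(avoid (insert u Lf)) : Set (Sym2 (Fin n))) :=
    determinedBy_offZ (insert u Lf) fun η => ((A \ Lf).filter fun a => η ∈ openConn o a).card = 0 ∧ η ∈ openConn o p
  have hdetX1 : DeterminedBy X1 (↑(avoid (insert u Lf)) : Set (Sym2 (Fin n)))ᶜ :=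
    determinedBy_pocket H fun P => 1 ≤ (Lf.filter fun ℓ => P ℓ).card
  have hdetX2 : DeterminedBy X2 (↑(avoid (insert u Lf)) : Set (Sym2 (Fin n)))ᶜ :=
    determinedBy_pocket H fun P => 2 ≤ (Lf.filter fun ℓ => P ℓ).card
  have hi1 : μ.real (S1 ∩ X1) = μ.real S1 * μ.real X1 :=
    prodBernoulli_real_inter_of_determinedBy v (avoid (insert u Lf)) hdetS1 hdetX1 (hmeas _) (hmeas _)
  have hi0 : μ.real (S0 ∩ X2) = μ.real S0 * μ.real X2 :=
    prodBernoulli_real_inter_of_determinedBy v (avoid (insert u Lf)) hdetS0 hdetX2 (hmeas _) (hmeas _)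
  rw [hST, hTsum, hi1, hi0]

/-- **Marginal of a leaf**: `P_v(o ↔ ℓ) = P_v(o ↔ p off Z) · P_v(pocket ℓ)` for `ℓ ∈ Lf`. [this work] -/
theorem real_openConn_leaf_eq (v : Sym2 (Fin n) → unitInterval)
    (hv : ∀ x y : Fin n, x ≠ y → (x ∈ insert u Lf ∨ y ∈ insert u Lf) → ¬ Allowed p u ℓ₁ Lf s(x, y) → (v s(x, y) : ℝ) = 0)
    {ℓ : Fin n} (hℓ : ℓ ∈ Lf) :
    (prodBernoulli v).real (openConn o ℓ) =
      (prodBernoulli v).real {ω | offZ (insert u Lf) ω ∈ openConn o p} * (prodBernoulli v).real {ω | pocket p u ℓ₁ ω ℓ} := by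
  have hmeas : ∀ U : Set (BondConfig (Fin n)), MeasurableSet U := fun U => (Set.toFinite U).measurableSet
  have h1 : (prodBernoulli v).real (openConn o ℓ) =
      (prodBernoulli v).real ({ω | offZ (insert u Lf) ω ∈ openConn o p} ∩ {ω | pocket p u ℓ₁ ω ℓ}) := by
    refine real_congr_of_good (p := p) (u := u) (ℓ₁ := ℓ₁) (Lf := Lf) v hv _ _ fun ω hω => ?_
    simp only [Set.mem_inter_iff, mem_setOf_eq]
    exact reach_leaf_iff H hω hℓ
  rw [h1]
  exact prodBernoulli_real_inter_of_determinedBy v (avoid (insert u Lf))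
    (determinedBy_offZ (insert u Lf) fun η => η ∈ openConn o p) (determinedBy_pocket H fun P => P ℓ) (hmeas _) (hmeas _)

/-- **Marginal of a vertex off the pocket**: `P_v(o ↔ a) = P_v(o ↔ a off Z)` for `a ∉ Z`. [this work] -/
theorem real_openConn_off_eq (v : Sym2 (Fin n) → unitInterval)
    (hv : ∀ x y : Fin n, x ≠ y → (x ∈ insert u Lf ∨ y ∈ insert u Lf) → ¬ Allowed p u ℓ₁ Lf s(x, y) → (v s(x, y) : ℝ) = 0)
    {a : Fin n} (ha : a ∉ insert u Lf) :
    (prodBernoulli v).real (openConn o a) = (prodBernoulli v).real {ω | offZ (insert u Lf) ω ∈ openConn o a} :=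
  real_congr_of_good (p := p) (u := u) (ℓ₁ := ℓ₁) (Lf := Lf) v hv _ _ fun _ hω => reach_iff_offZ H hω ha

end Pocket

/-- **Coefficients do not see the pocket weights**: two weight functions agreeing on the pairs avoiding `Z` give the same probability
to every event read off `offZ Z`. [this work] -/
theorem real_offZ_event_eq_of_agree (v v' : Sym2 (Fin n) → unitInterval) (Z : Finset (Fin n))
    (hvv' : ∀ e ∈ avoid Z, v e = v' e) (P : BondConfig (Fin n) → Prop) :
    (prodBernoulli v).real {ω | P (offZ Z ω)} = (prodBernoulli v').real {ω | P (offZ Z ω)} :=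
  prodBernoulli_real_eq_of_determinedBy v v' (fun e he => hvv' e (Finset.mem_coe.1 he)) (determinedBy_offZ Z P)
    (Set.toFinite _).measurableSet

end Bundle

end Quant

end Summit.CriticalPhenomena.PercolationContinuityZ3.Theorems
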